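import Literature.NumberTheory.EllipticCurves.Tian2014.CMPointSystemSpecialTransversal
import Literature.NumberTheory.EllipticCurves.Tian2014.CongruentNumbersHeegnerPoints
import HarnessLib

/-!
# Tian's transversal `φ = ⋃_{[s]∈ψ} [s]φ₀` of `𝒜/[ϖ′]` for `p₀ ≡ 7 (mod 8)`, `k ≥ 1` (proof of Thm. 4.4):
# the special transversal `φ₀ = ⋃_{i<s} [t₀]^{2i} φ₁` of `2𝒜/[ϖ′]` and its lift along representatives of `𝒜/2𝒜` —
# the finite-abelian-group facts, for an abstract finite abelian group

Cell `bsd-monsky` (prover-A seat, g15; `run/shared/lean/pub/bsd-monsky/`). HONEST FRAMING (README §1): pure finite abelian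
group theory — the objects of Tian 2014's proof of Thm. 4.4 (`p₀ ≡ 7 (mod 8)`, `k ≥ 1`), stated for an abstract finite
abelian group `G` (for `G = Cl(ℚ(√−2n))` the two cardinalities below are Gauss's genus theory and Rédei–Reichardt, tree
theorems). Nothing asserted about curves; no named fact.

## Source (verbatim, arXiv:1210.8231)

* p0025 L21–L25: "Let `k ≥ 1` be an integer and `n = p₀p₁⋯p_k` with `p₀ ≡ 7 mod 8` and `p_i ≡ 1 mod 8` for `1 ≤ i ≤ k`.
  Note that `[ϖ′] ∈ 2𝒜 ∩ 𝒜[2]`. Let `φ₀` be a set of representatives of `2𝒜/([ϖ′])`. Let `ψ` be a set of representatives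
  of `𝒜/2𝒜`. Then `φ = ⋃_{[s]∈ψ} [s]φ₀` is a set of representatives of `𝒜/([ϖ′])`. We use this `φ` to define all `y_d`'s."
* p0026 L26–L38: "The assumption `dim_{𝔽₂} 𝒜[4]/𝒜[2] = 1` implies that `[ϖ′]` is the unique non-trivial element in
  `2𝒜 ∩ 𝒜[2]`. … Write `β = σ_{t₀}`, then `[t₀] ∈ 𝒜 ∖ 2𝒜` has order `4s` for some integer `s`. Then `[t₀]^{2s} = [ϖ′]` and the
  group `2𝒜/([t₀]²)` is of odd order. Let `φ₁` be a set of representatives for the group `2𝒜/([t₀]²)`, then we may take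
  `φ₀ = ⋃_{i=0}^{s−1} [t₀]^{2i} φ₁` to be our set of representative for `2𝒜/([ϖ′])` and use it to define `y₀`."
* Notations (i) (p0005 L22–L26): "the subgroup `𝒜[2]` consists of the ideal classes of `(d, √−2n)` … `𝒜[2]` has cardinality
  `2^{k+1}`" — for `n = p₀p₁`: `𝒜[2] = {1, [ϖ′], [ϖ′_{p₁}], [ϖ′][ϖ′_{p₁}]}`.

## What is proved (kernel)

* §1 listings from cardinalities: `G[2] ⊆ {1, π, B, πB}` when `#G[2] = 4` (`eq_one_or_eq_of_mul_self_eq_one_of_natCard_eq_four`);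
  `2G ∩ G[2] ⊆ {1, π}` when `#(2G ∩ G[2]) = 2` and `π` is a square of order `2` (Tian's (1.1) for `p₀ ≡ 7 (8)`, p0022 L69–L71;
  `eq_one_or_eq_of_isSquare_of_mul_self_eq_one_of_fourTwoCard_eq_two`).
* §2 the special transversal INSIDE the subgroup of squares (`exists_special_transversal_isSquare`): for `π ∈ 2G` of order `2`
  with `2G ∩ G[2] = {1, π}` and a square `t` which is not the square of a square, a transversal `φ₀ ⊆ 2G` of `2G/⟨π⟩` of the
  form `⋃_{i<m} t^i φ₁`, `#φ₁` odd, `t^m = π` — `CMPointSystemSpecialTransversal.exists_special_transversal` applied to the group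
  `2G` and read back in `G`.
* §3 the lift (`isReps_image_mul_of_isReps_isSquare`, `sum_image_mul_eq`): for representatives `c : ι → G` of `G/2G` (every
  `a ∈ G` is `c_i·g` with `g ∈ 2G`, and `c_i^{-1}c_j ∈ 2G` only for `i = j`) and a transversal `φ₀ ⊆ 2G` of `2G/⟨π⟩`, the set
  `φ = ⋃_i c_i φ₀` is a transversal of `G/⟨π⟩`, and `Σ_{a∈φ} f(a) = Σ_i Σ_{g∈φ₀} f(c_i g)` — Tian's `φ = ⋃_{[s]∈ψ} [s]φ₀`.

[cite: Tian2014, proof of Thm. 4.4 (arXiv:1210.8231 p0025 L19–L25, p0026 L26–L38), §4.2 (p0022 L66–L76), Notations (i)–(ii) (p0005 L22–L30)]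
[cite: Cox2013, Prop. 3.11] [cite: LiMa2008, Thm. 0.4]
-/

noncomputable section

open scoped Classical

set_option autoImplicit false

namespace Literature.NumberTheory.EllipticCurves.Tian2014

/-! ## §1 Listings of `G[2]` and of `2G ∩ G[2]` from their cardinalities -/

section Listings

variable {G : Type*} [CommGroup G]

/-- **`G[2] = {1, π, B, πB}` when `#G[2] = 4`** and `π`, `B` are distinct non-trivial elements of order `2` (Gauss: for
`K = ℚ(√−2p₀p₁)` the `2`-torsion consists of the four ambiguous classes `1, [ϖ′], [ϖ′_{p₁}], [ϖ′][ϖ′_{p₁}]`).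
[cite: Tian2014, Notations (i) (p0005 L22–L26)] [cite: Cox2013, Prop. 3.11] -/
theorem eq_one_or_eq_of_mul_self_eq_one_of_natCard_eq_four (π B : G) (hπ2 : π * π = 1) (hπ1 : π ≠ 1)
    (hB2 : B * B = 1) (hB1 : B ≠ 1) (hBπ : B ≠ π) (hcard : Nat.card {c : G // c ^ 2 = 1} = 4) :
    ∀ u : G, u * u = 1 → u = 1 ∨ u = π ∨ u = B ∨ u = π * B := by
  intro u hu
  by_contra hne
  have hu1 : u ≠ 1 := fun h => hne (Or.inl h)
  have huπ : u ≠ π := fun h => hne (Or.inr (Or.inl h))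
  have huB : u ≠ B := fun h => hne (Or.inr (Or.inr (Or.inl h)))
  have huπB : u ≠ π * B := fun h => hne (Or.inr (Or.inr (Or.inr h)))
  have hπB1 : π * B ≠ 1 := fun h => hBπ (by
    have := congrArg (fun x => π * x) h
    rwa [← mul_assoc, hπ2, one_mul, mul_one] at this)
  have hπBπ : π * B ≠ π := fun h => hB1 (by
    have := congrArg (fun x => π * x) h
    rwa [← mul_assoc, hπ2, one_mul] at this)
  have hπBB : π * B ≠ B := fun h => hπ1 (mul_right_cancel (h.trans (one_mul B).symm))
  haveI : Finite {c : G // c ^ 2 = 1} := Nat.finite_of_card_ne_zero (by rw [hcard]; norm_num)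
  haveI : Fintype {c : G // c ^ 2 = 1} := Fintype.ofFinite _
  set T : Finset G := {1, π, B, π * B, u} with hT
  have hTcard : T.card = 5 := by
    rw [hT, Finset.card_insert_of_notMem, Finset.card_insert_of_notMem, Finset.card_insert_of_notMem,
      Finset.card_insert_of_notMem, Finset.card_singleton]
    · simp only [Finset.mem_singleton]; exact huπB.symm
    · simp only [Finset.mem_insert, Finset.mem_singleton, not_or]; exact ⟨hπBB.symm, huB.symm⟩
    · simp only [Finset.mem_insert, Finset.mem_singleton, not_or]; exact ⟨hBπ.symm, hπBπ.symm, huπ.symm⟩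
    · simp only [Finset.mem_insert, Finset.mem_singleton, not_or]
      exact ⟨hπ1.symm, hB1.symm, hπB1.symm, hu1.symm⟩
  have hTsq : ∀ x ∈ T, x ^ 2 = 1 := by
    intro x hx
    rw [hT] at hx
    simp only [Finset.mem_insert, Finset.mem_singleton] at hx
    rcases hx with rfl | rfl | rfl | rfl | rfl
    · exact one_pow 2
    · rw [sq, hπ2]
    · rw [sq, hB2]
    · rw [sq, mul_mul_mul_comm, hπ2, hB2, one_mul]
    · rw [sq, hu]
  have hle := Finset.card_le_univ (T.subtype (fun c : G => c ^ 2 = 1))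
  rw [Finset.card_subtype, Finset.filter_true_of_mem hTsq, hTcard, ← Nat.card_eq_fintype_card, hcard] at hle
  omega

/-- **`2G ∩ G[2] = {1, π}` when `#(2G ∩ G[2]) = 2`** and `π` is a square of order `2` — Tian's condition (1.1) for
`p₀ ≡ 7 (mod 8)`: "the class of `ϖ′ ∈ K₂ˣ` in `𝒜` is the only non-trivial element in `𝒜[2] ∩ 2𝒜`".
[cite: Tian2014, §4.2 (p0022 L66–L71), proof of Lemma 5.1 (p. 28, L13–L16)] -/
theorem eq_one_or_eq_of_isSquare_of_mul_self_eq_one_of_fourTwoCard_eq_two (π : G) (hπsq : IsSquare π)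
    (hπ2 : π * π = 1) (hπ1 : π ≠ 1) (hcard : fourTwoCard G = 2) :
    ∀ u : G, IsSquare u → u * u = 1 → u = 1 ∨ u = π := by
  intro u husq hu
  by_contra hne
  have hu1 : u ≠ 1 := fun h => hne (Or.inl h)
  have huπ : u ≠ π := fun h => hne (Or.inr h)
  rw [fourTwoCard_def] at hcard
  haveI : Finite {a : G // IsSquare a ∧ a ^ 2 = 1} := Nat.finite_of_card_ne_zero (by rw [hcard]; norm_num)
  haveI : Fintype {a : G // IsSquare a ∧ a ^ 2 = 1} := Fintype.ofFinite _
  set T : Finset G := {1, π, u} with hT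
  have hTcard : T.card = 3 := by
    rw [hT, Finset.card_insert_of_notMem, Finset.card_insert_of_notMem, Finset.card_singleton]
    · simp only [Finset.mem_singleton]; exact huπ.symm
    · simp only [Finset.mem_insert, Finset.mem_singleton, not_or]; exact ⟨hπ1.symm, hu1.symm⟩
  have hTsq : ∀ x ∈ T, IsSquare x ∧ x ^ 2 = 1 := by
    intro x hx
    rw [hT] at hx
    simp only [Finset.mem_insert, Finset.mem_singleton] at hx
    rcases hx with rfl | rfl | rfl
    · exact ⟨IsSquare.one, one_pow 2⟩
    · exact ⟨hπsq, by rw [sq, hπ2]⟩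
    · exact ⟨husq, by rw [sq, hu]⟩
  have hle := Finset.card_le_univ (T.subtype (fun a : G => IsSquare a ∧ a ^ 2 = 1))
  rw [Finset.card_subtype, Finset.filter_true_of_mem hTsq, hTcard, ← Nat.card_eq_fintype_card, hcard] at hle
  omega

end Listings

/-! ## §2 The special transversal of `2G/⟨π⟩` inside the subgroup of squares -/

section SquaresTransversal

variable {G : Type*} [CommGroup G] [Finite G]

/-- **Tian's transversal `φ₀ = ⋃_{i<s} [t₀]^{2i} φ₁` of `2𝒜/([ϖ′])`** (proof of Thm. 4.4, p0026 L32–L38), for an abstract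
finite abelian group `G`: if `π ∈ 2G` has order `2`, `2G ∩ G[2] = {1, π}` (condition (1.1)), and `t ∈ 2G` is not the square of
a square (for `t = [t₀]²`), then there are `φ₀ ⊆ 2G`, a transversal of `2G/⟨π⟩`, and `φ₁` of ODD cardinality (representatives of
`2G/⟨t⟩`, "of odd order") with `t^m = π` and `Σ_{a∈φ₀} f(a) = Σ_{i<m} Σ_{u∈φ₁} f(t^i u)` for every `f` — the special
transversal of `CMPointSystemSpecialTransversal` applied to the group `2G`. [cite: Tian2014, proof of Thm. 4.4 (p0026 L26–L38)] -/
theorem exists_special_transversal_isSquare (π : G) (hπsq : IsSquare π)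
    (h2 : ∀ u : G, IsSquare u → u * u = 1 → u = 1 ∨ u = π) (t : G) (htsq : IsSquare t)
    (ht : ¬ ∃ r : G, IsSquare r ∧ t = r * r) :
    ∃ (φ₀ φ₁ : Finset G) (m : ℕ), t ^ m = π ∧ Odd φ₁.card ∧ (∀ g ∈ φ₀, IsSquare g) ∧
      (∀ g, IsSquare g → Xor (g ∈ φ₀) (π * g ∈ φ₀)) ∧
      ∀ {M : Type} [AddCommGroup M] (f : G → M),
        ∑ a ∈ φ₀, f a = ∑ i ∈ Finset.range m, ∑ u ∈ φ₁, f (t ^ i * u) := by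
  classical
  -- the subgroup of squares `2G`
  have hmem : ∀ a : G, a ∈ (powMonoidHom 2 : G →* G).range ↔ IsSquare a := by
    intro a
    rw [MonoidHom.mem_range]
    constructor
    · rintro ⟨r, hr⟩
      exact ⟨r, by rw [← hr, powMonoidHom_apply, sq]⟩
    · rintro ⟨r, hr⟩
      exact ⟨r, by rw [powMonoidHom_apply, sq, hr]⟩
  have h2' : ∀ u : (powMonoidHom 2 : G →* G).range, u * u = 1 →
      u = 1 ∨ u = ⟨π, (hmem π).mpr hπsq⟩ := by
    intro u hu
    have hu' : (u : G) * u = 1 := by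
      have := congrArg Subtype.val hu
      simpa using this
    rcases h2 u ((hmem u).mp u.2) hu' with h | h
    · left; exact Subtype.ext h
    · right; exact Subtype.ext h
  have ht'' : ¬ IsSquare (⟨t, (hmem t).mpr htsq⟩ : (powMonoidHom 2 : G →* G).range) := by
    rintro ⟨r, hr⟩
    apply ht
    refine ⟨r, (hmem r).mp r.2, ?_⟩
    have := congrArg Subtype.val hr
    simpa using this
  obtain ⟨φ', φ₀', m, -, htm', hodd', hφ', hsum'⟩ :=
    exists_special_transversal (G := (powMonoidHom 2 : G →* G).range) ⟨π, (hmem π).mpr hπsq⟩ h2'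
      ⟨t, (hmem t).mpr htsq⟩ ht''
  refine ⟨φ'.map (Function.Embedding.subtype _), φ₀'.map (Function.Embedding.subtype _), m, ?_, ?_, ?_, ?_, ?_⟩
  · have := congrArg Subtype.val htm'
    simpa using this
  · rw [Finset.card_map]; exact hodd'
  · intro g hg
    rw [Finset.mem_map] at hg
    obtain ⟨s, -, rfl⟩ := hg
    exact (hmem _).mp s.2
  · intro g hg
    have h1 : g ∈ φ'.map (Function.Embedding.subtype _) ↔
        (⟨g, (hmem g).mpr hg⟩ : (powMonoidHom 2 : G →* G).range) ∈ φ' :=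
      Finset.mem_map' (Function.Embedding.subtype _) (a := ⟨g, (hmem g).mpr hg⟩)
    have h2'' : π * g ∈ φ'.map (Function.Embedding.subtype _) ↔
        (⟨π, (hmem π).mpr hπsq⟩ : (powMonoidHom 2 : G →* G).range) * ⟨g, (hmem g).mpr hg⟩ ∈ φ' :=
      Finset.mem_map' (Function.Embedding.subtype _)
        (a := (⟨π, (hmem π).mpr hπsq⟩ : (powMonoidHom 2 : G →* G).range) * ⟨g, (hmem g).mpr hg⟩)
    rw [h1, h2'']
    exact hφ' _
  · intro M _ f
    rw [Finset.sum_map]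
    simp only [Function.Embedding.coe_subtype]
    rw [hsum' (fun a => f a)]
    refine Finset.sum_congr rfl (fun i _ => ?_)
    rw [Finset.sum_map]
    simp only [Function.Embedding.coe_subtype, Subgroup.coe_mul, Subgroup.coe_pow]

end SquaresTransversal

/-! ## §3 The lift `φ = ⋃_i c_i φ₀` along representatives of `G/2G` -/

section CosetLift

variable {G : Type*} [CommGroup G] {ι : Type*} [Fintype ι]

/-- **Injectivity of `(i, g) ↦ c_i g`** on `ι × 2G` for representatives `c` of `G/2G`. [cite: Tian2014, proof of Thm. 4.4 (p0025 L21–L25)] -/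
theorem mul_injOn_of_reps (c : ι → G) (hCu : ∀ i j, IsSquare ((c i)⁻¹ * c j) → i = j)
    {φ₀ : Finset G} (hφ₀S : ∀ g ∈ φ₀, IsSquare g) :
    ∀ p ∈ (Finset.univ : Finset ι) ×ˢ φ₀, ∀ q ∈ (Finset.univ : Finset ι) ×ˢ φ₀,
      c p.1 * p.2 = c q.1 * q.2 → p = q := by
  rintro ⟨i, g⟩ hp ⟨j, g'⟩ hq heq
  simp only [Finset.mem_product, Finset.mem_univ, true_and] at hp hq heq
  have hij : i = j := by
    apply hCu
    have : (c i)⁻¹ * c j = g * g'⁻¹ := by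
      rw [inv_mul_eq_iff_eq_mul, ← mul_assoc, heq, mul_assoc, mul_inv_cancel, mul_one]
    rw [this]
    exact (hφ₀S g hp).mul ((isSquare_inv).mpr (hφ₀S g' hq))
  subst hij
  have : g = g' := mul_left_cancel heq
  rw [this]

/-- **The lift of a transversal of `2G/⟨π⟩` to a transversal of `G/⟨π⟩`** (Tian: "`φ = ⋃_{[s]∈ψ} [s]φ₀` is a set of
representatives of `𝒜/([ϖ′])`"): for `π ∈ 2G`, representatives `c : ι → G` of `G/2G` (`hC`, `hCu`) and a transversal
`φ₀ ⊆ 2G` of `2G/⟨π⟩`, the image of `(i, g) ↦ c_i g` is a transversal of `G/⟨π⟩`.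
[cite: Tian2014, proof of Thm. 4.4 (p0025 L21–L25)] -/
theorem isReps_image_mul_of_isReps_isSquare {π : G} (hπsq : IsSquare π) (c : ι → G)
    (hC : ∀ a : G, ∃ i, IsSquare ((c i)⁻¹ * a)) (hCu : ∀ i j, IsSquare ((c i)⁻¹ * c j) → i = j)
    {φ₀ : Finset G} (hφ₀S : ∀ g ∈ φ₀, IsSquare g) (hφ₀ : ∀ g, IsSquare g → Xor (g ∈ φ₀) (π * g ∈ φ₀)) :
    ∀ a, Xor (a ∈ ((Finset.univ : Finset ι) ×ˢ φ₀).image (fun p : ι × G => c p.1 * p.2))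
      (π * a ∈ ((Finset.univ : Finset ι) ×ˢ φ₀).image (fun p : ι × G => c p.1 * p.2)) := by
  classical
  intro a
  obtain ⟨i, hi⟩ := hC a
  have hag : a = c i * ((c i)⁻¹ * a) := by rw [mul_inv_cancel_left]
  -- membership of `c_j g'` in the image is decided by the unique representation
  have hmem : ∀ b, b ∈ ((Finset.univ : Finset ι) ×ˢ φ₀).image (fun p : ι × G => c p.1 * p.2) ↔
      ∃ j, ∃ g' ∈ φ₀, c j * g' = b := by
    intro b
    rw [Finset.mem_image]
    constructor
    · rintro ⟨⟨j, g'⟩, hp, rfl⟩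
      rw [Finset.mem_product] at hp
      exact ⟨j, g', hp.2, rfl⟩
    · rintro ⟨j, g', hg', rfl⟩
      exact ⟨(j, g'), Finset.mem_product.mpr ⟨Finset.mem_univ _, hg'⟩, rfl⟩
  have hkey : ∀ g' : G, IsSquare g' →
      ((c i * g') ∈ ((Finset.univ : Finset ι) ×ˢ φ₀).image (fun p : ι × G => c p.1 * p.2) ↔ g' ∈ φ₀) := by
    intro g' hg'
    rw [hmem]
    constructor
    · rintro ⟨j, g'', hg'', heq⟩
      have hij : i = j := by
        apply hCu
        have : (c i)⁻¹ * c j = g' * g''⁻¹ := by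
          rw [inv_mul_eq_iff_eq_mul, ← mul_assoc, ← heq, mul_assoc, mul_inv_cancel, mul_one]
        rw [this]
        exact hg'.mul ((isSquare_inv).mpr (hφ₀S g'' hg''))
      subst hij
      rw [← mul_left_cancel heq]
      exact hg''
    · intro h
      exact ⟨i, g', h, rfl⟩
  have hπg : IsSquare (π * ((c i)⁻¹ * a)) := hπsq.mul hi
  rw [hag, show π * (c i * ((c i)⁻¹ * a)) = c i * (π * ((c i)⁻¹ * a)) from mul_left_comm _ _ _,
    hkey _ hi, hkey _ hπg]
  exact hφ₀ _ hi

/-- **The sum over the lifted transversal**: `Σ_{a ∈ ⋃_i c_i φ₀} f(a) = Σ_i Σ_{g∈φ₀} f(c_i g)`.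
[cite: Tian2014, proof of Lemma 4.8 (p0025 L59–L81: "Σ_{[t]∈φ₀} Σ_{[s]∈ψ} …")] -/
theorem sum_image_mul_eq (c : ι → G) (hCu : ∀ i j, IsSquare ((c i)⁻¹ * c j) → i = j)
    {φ₀ : Finset G} (hφ₀S : ∀ g ∈ φ₀, IsSquare g) {M : Type*} [AddCommGroup M] (f : G → M) :
    ∑ a ∈ ((Finset.univ : Finset ι) ×ˢ φ₀).image (fun p : ι × G => c p.1 * p.2), f a =
      ∑ i, ∑ g ∈ φ₀, f (c i * g) := by
  classical
  rw [Finset.sum_image (fun p hp q hq h => mul_injOn_of_reps c hCu hφ₀S p hp q hq h), Finset.sum_product]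

end CosetLift

end Literature.NumberTheory.EllipticCurves.Tian2014

end
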